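import Mathlib
import HarnessLib
import Literature.NumberTheory.LFunctions.PrimeReciprocalWindows

/-!
# Short-time dipole floor, helper 1: a one-dimensional comparison lemma for linearly damped integral equations

Helper (`--supports stmt-AtomisticToContinuum-11749`) for stub `stub_shortTimeDipoleFloor` (S) of line
`kick-dipole-no-collapse`, crux `JunctionLocality.ConductanceLowerBound`.  Pure real analysis, no chain objects.

The time-reversed kick pairing `ψ(r) = ∫ J · (κ_r g) dμ_T` of the line (`g` the Kundu–Dhar–Narayan source, `J` the total
current) obeys, by Dynkin's identity for `g` and `L g = (γ/2)(A_0 − A_{N-1}) − 2γ g`, the linearly damped integral equation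
`ψ(r) = ∫₀ʳ (b(s) − α ψ(s)) ds`, `α = 2γ`, with a forcing `b` that is `≤ −c < 0` for short times.  This file supplies the
elementary comparison principle turning that into `ψ(r) ≤ −(c/α)(1 − e^{−α r})`, WITHOUT differentiating `ψ` or `b`
(they are only known to be integrable): with `Θ = ∫₀ b + c·` nonincreasing and `X = ∫₀ χ`, the function
`s ↦ e^{αs} X(s) − Θ(r)(e^{αs} − 1)/α` is monotone on `[0, r]` (its derivative is `e^{αs}(Θ(s) − Θ(r)) ≥ 0`).

* `nonpos_of_dampedIntegralEq` — `χ(r) = ∫₀ʳ θ − α ∫₀ʳ χ` with `θ ≤ 0` forces `χ ≤ 0`;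
* `le_of_dampedIntegralEq_of_forcing_le` — `ψ(r) = ∫₀ʳ (b − αψ)`, `b ≤ −c` give `ψ(r) ≤ −(c/α)(1 − e^{−αr})`;
* `sq_floor_of_kernel_floor` — `∫₀^{t₀} 𝒥 ≥ γ t₀²/8` once `𝒥(r) ≥ (1 − e^{−2γr})/4` on `[0, t₀]`, `2γt₀ ≤ 1`
  (`x/2 ≤ 1 − e^{−x}` on `[0,1]`, the tree's `PrimeReciprocal.half_le_one_sub_exp_neg`).
-/

noncomputable section

open MeasureTheory Set Filter Topology intervalIntegral

namespace Summit.AtomisticToContinuum.FouriersLaw.Cruxes.ConductanceLowerBound.KickDipoleNoCollapse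

/-- Interval integrability on a sub-interval `[s, r] ⊆ [0, t₁]` of a function integrable on `[0, t₁]`. -/
theorem intervalIntegrable_of_integrableOn_Icc {f : ℝ → ℝ} {t₁ s r : ℝ} (hf : IntegrableOn f (Icc 0 t₁))
    (hs : 0 ≤ s) (hsr : s ≤ r) (hr : r ≤ t₁) : IntervalIntegrable f volume s r :=
  (hf.mono_set (by rw [uIcc_of_le hsr]; exact Icc_subset_Icc hs hr)).intervalIntegrable

/-- **Sub-solution principle for a linearly damped integral equation.** If `χ(r) = ∫₀ʳ θ − α ∫₀ʳ χ` on `[0, t₁]`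
with `α > 0`, `χ, θ` integrable on `[0, t₁]` and `θ ≤ 0` there, then `χ ≤ 0` on `[0, t₁]`. -/
theorem nonpos_of_dampedIntegralEq {χ θ : ℝ → ℝ} {α t₁ : ℝ} (hα : 0 < α) (ht₁ : 0 ≤ t₁)
    (hχ : IntegrableOn χ (Icc 0 t₁)) (hθ : IntegrableOn θ (Icc 0 t₁))
    (heq : ∀ r ∈ Icc 0 t₁, χ r = (∫ s in (0:ℝ)..r, θ s) - α * ∫ s in (0:ℝ)..r, χ s)
    (hθ0 : ∀ s ∈ Icc 0 t₁, θ s ≤ 0) :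
    ∀ r ∈ Icc 0 t₁, χ r ≤ 0 := by
  set Θ : ℝ → ℝ := fun r => ∫ s in (0:ℝ)..r, θ s with hΘ
  set X : ℝ → ℝ := fun r => ∫ s in (0:ℝ)..r, χ s with hX
  have hΘc : ContinuousOn Θ (Icc 0 t₁) := by
    have h := intervalIntegral.continuousOn_primitive_interval (μ := volume) (f := θ) (a := 0) (b := t₁)
      (by rwa [uIcc_of_le ht₁])
    rwa [uIcc_of_le ht₁] at h
  have hXc : ContinuousOn X (Icc 0 t₁) := by
    have h := intervalIntegral.continuousOn_primitive_interval (μ := volume) (f := χ) (a := 0) (b := t₁)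
      (by rwa [uIcc_of_le ht₁])
    rwa [uIcc_of_le ht₁] at h
  -- `χ = Θ - α X` on the interval, hence continuous there
  have hχc : ContinuousOn χ (Icc 0 t₁) :=
    (hΘc.sub (continuousOn_const.mul hXc)).congr (fun r hr => heq r hr)
  -- `Θ` is nonincreasing on the interval
  have hΘanti : ∀ s r, s ∈ Icc 0 t₁ → r ∈ Icc 0 t₁ → s ≤ r → Θ r ≤ Θ s := by
    intro s r hs hr hsr
    have h0r : IntervalIntegrable θ volume 0 r := intervalIntegrable_of_integrableOn_Icc hθ le_rfl hr.1 hr.2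
    have h0s : IntervalIntegrable θ volume 0 s := intervalIntegrable_of_integrableOn_Icc hθ le_rfl hs.1 hs.2
    have hsub : Θ r - Θ s = ∫ u in s..r, θ u := intervalIntegral.integral_interval_sub_left h0r h0s
    have hneg : ∫ u in s..r, θ u ≤ 0 := by
      have h1 : 0 ≤ ∫ u in s..r, -θ u :=
        intervalIntegral.integral_nonneg hsr fun u hu => neg_nonneg.2 (hθ0 u ⟨hs.1.trans hu.1, hu.2.trans hr.2⟩)
      rw [intervalIntegral.integral_neg] at h1
      linarith
    linarith
  -- `X' = χ` at interior points
  have hXd : ∀ r ∈ Ioo 0 t₁, HasDerivAt X (χ r) r := by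
    intro r hr
    refine intervalIntegral.integral_hasDerivAt_right
      (intervalIntegrable_of_integrableOn_Icc hχ le_rfl hr.1.le hr.2.le) ?_ ?_
    · exact (hχc.mono Ioo_subset_Icc_self).stronglyMeasurableAtFilter isOpen_Ioo r hr
    · exact hχc.continuousAt (Icc_mem_nhds hr.1 hr.2)
  intro r hr
  rcases hr.1.eq_or_lt with h0 | hrpos
  · rw [heq r hr, ← h0]
    simp
  -- monotonicity of `Z(s) = e^{αs} X(s) - Θ(r) (e^{αs} - 1)/α` on `[0, r]`
  have hZ : Θ r * (Real.exp (α * r) - 1) / α ≤ Real.exp (α * r) * X r := by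
    set Z : ℝ → ℝ := fun s => Real.exp (α * s) * X s - Θ r * (Real.exp (α * s) - 1) / α with hZdef
    have hexpd : ∀ s, HasDerivAt (fun u => Real.exp (α * u)) (α * Real.exp (α * s)) s := by
      intro s
      have h1 : HasDerivAt (fun u : ℝ => α * u) α s := by
        simpa using ((hasDerivAt_id s).const_mul α)
      exact h1.exp.congr_deriv (by ring)
    have hZc : ContinuousOn Z (Icc 0 r) := by
      have hXc' : ContinuousOn X (Icc 0 r) := hXc.mono (Icc_subset_Icc le_rfl hr.2)
      have he : Continuous fun s => Real.exp (α * s) := by fun_prop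
      exact (he.continuousOn.mul hXc').sub ((continuousOn_const.mul (he.continuousOn.sub continuousOn_const)).div_const _)
    have hZd : ∀ s ∈ Ioo 0 r, HasDerivAt Z (Real.exp (α * s) * (Θ s - Θ r)) s := by
      intro s hs
      have hs' : s ∈ Ioo 0 t₁ := ⟨hs.1, hs.2.trans_le hr.2⟩
      have h3 : HasDerivAt Z (α * Real.exp (α * s) * X s + Real.exp (α * s) * χ s -
          Θ r * (α * Real.exp (α * s)) / α) s :=
        ((hexpd s).mul (hXd s hs')).sub (((hexpd s).sub_const 1).const_mul (Θ r) |>.div_const α)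
      convert h3 using 1
      rw [heq s ⟨hs.1.le, hs'.2.le⟩]
      field_simp
      ring
    have hmono : MonotoneOn Z (Icc 0 r) := by
      refine monotoneOn_of_deriv_nonneg (convex_Icc 0 r) hZc (fun s hs => ?_) (fun s hs => ?_)
      · rw [interior_Icc] at hs
        exact (hZd s hs).differentiableAt.differentiableWithinAt
      · rw [interior_Icc] at hs
        rw [(hZd s hs).deriv]
        exact mul_nonneg (Real.exp_pos _).le
          (sub_nonneg.2 (hΘanti s r ⟨hs.1.le, hs.2.le.trans hr.2⟩ hr hs.2.le))
    have h := hmono (left_mem_Icc.2 hr.1) (right_mem_Icc.2 hr.1) hr.1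
    have hZ0 : Z 0 = 0 := by simp [hZdef, hX]
    rw [hZ0] at h
    have : Z r = Real.exp (α * r) * X r - Θ r * (Real.exp (α * r) - 1) / α := rfl
    linarith
  rw [heq r hr]
  have hΘr : Θ r ≤ 0 := by
    have h := hΘanti 0 r ⟨le_rfl, ht₁⟩ hr hr.1
    have h0 : Θ 0 = 0 := by simp [hΘ]
    linarith
  have hexp : 0 < Real.exp (α * r) := Real.exp_pos _
  have h1 : Θ r * (Real.exp (α * r) - 1) ≤ α * (Real.exp (α * r) * X r) := by
    rw [div_le_iff₀ hα] at hZ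
    linarith
  have h2 : Real.exp (α * r) * (Θ r - α * X r) ≤ Θ r := by nlinarith [h1]
  by_contra hcon
  push Not at hcon
  nlinarith [mul_pos hexp hcon]

/-- **Comparison for the damped kick pairing.** If `ψ(r) = ∫₀ʳ (b(s) − α ψ(s)) ds` on `[0, t₁]` (`α > 0`, `ψ, b`
integrable there) and the forcing satisfies `b ≤ −c` on `[0, t₁]`, then `ψ(r) ≤ −(c/α)(1 − e^{−αr})` on `[0, t₁]`
(`ψ` lies below the solution of `y' = −c − αy`, `y(0) = 0`). -/
theorem le_of_dampedIntegralEq_of_forcing_le {ψ b : ℝ → ℝ} {α c t₁ : ℝ} (hα : 0 < α) (ht₁ : 0 ≤ t₁)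
    (hψ : IntegrableOn ψ (Icc 0 t₁)) (hb : IntegrableOn b (Icc 0 t₁))
    (heq : ∀ r ∈ Icc 0 t₁, ψ r = ∫ s in (0:ℝ)..r, (b s - α * ψ s))
    (hbc : ∀ s ∈ Icc 0 t₁, b s ≤ -c) :
    ∀ r ∈ Icc 0 t₁, ψ r ≤ -(c / α) * (1 - Real.exp (-(α * r))) := by
  have hysc : Continuous fun r : ℝ => -(c / α) * (1 - Real.exp (-(α * r))) := by fun_prop
  -- the comparison solution solves `ys(r) = ∫₀ʳ (-c - α ys)`
  have hys_eq : ∀ r, -(c / α) * (1 - Real.exp (-(α * r))) =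
      ∫ s in (0:ℝ)..r, (-c - α * (-(c / α) * (1 - Real.exp (-(α * s))))) := by
    intro r
    have hF : ∀ s, HasDerivAt (fun u => (c / α) * Real.exp (-(α * u))) (-c * Real.exp (-(α * s))) s := by
      intro s
      have h1 : HasDerivAt (fun u : ℝ => -(α * u)) (-α) s := by
        have := (hasDerivAt_id s).const_mul (-α)
        simp only [id_eq, mul_one] at this
        exact this.congr_of_eventuallyEq (Filter.Eventually.of_forall fun u => by ring)
      exact ((h1.exp).const_mul (c / α)).congr_deriv (by field_simp)
    have hint : ∫ s in (0:ℝ)..r, (-c - α * (-(c / α) * (1 - Real.exp (-(α * s))))) =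
        ∫ s in (0:ℝ)..r, -c * Real.exp (-(α * s)) := by
      refine intervalIntegral.integral_congr fun s _ => ?_
      field_simp
      ring
    rw [hint, intervalIntegral.integral_eq_sub_of_hasDerivAt (fun s _ => hF s)
      ((by fun_prop : Continuous fun s => -c * Real.exp (-(α * s))).intervalIntegrable 0 r)]
    simp only [mul_zero, neg_zero, Real.exp_zero, mul_one]
    ring
  have key := nonpos_of_dampedIntegralEq (χ := fun r => ψ r - -(c / α) * (1 - Real.exp (-(α * r))))
    (θ := fun s => b s + c) hα ht₁
    (hψ.sub (hysc.continuousOn.integrableOn_compact isCompact_Icc))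
    (hb.add (continuous_const.continuousOn.integrableOn_compact isCompact_Icc)) ?_ ?_
  · intro r hr
    have h := key r hr
    linarith
  · intro r hr
    have hψi : IntervalIntegrable ψ volume 0 r := intervalIntegrable_of_integrableOn_Icc hψ le_rfl hr.1 hr.2
    have hbi : IntervalIntegrable b volume 0 r := intervalIntegrable_of_integrableOn_Icc hb le_rfl hr.1 hr.2
    have hysi : IntervalIntegrable (fun r : ℝ => -(c / α) * (1 - Real.exp (-(α * r)))) volume 0 r :=
      hysc.intervalIntegrable 0 r
    have hci : IntervalIntegrable (fun _ => c) volume 0 r := intervalIntegrable_const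
    have hnci : IntervalIntegrable (fun _ => -c) volume 0 r := intervalIntegrable_const
    show ψ r - -(c / α) * (1 - Real.exp (-(α * r))) =
      (∫ s in (0:ℝ)..r, (b s + c)) - α * ∫ s in (0:ℝ)..r, (ψ s - -(c / α) * (1 - Real.exp (-(α * s))))
    rw [heq r hr, hys_eq r, intervalIntegral.integral_sub hbi (hψi.const_mul α),
      intervalIntegral.integral_sub hnci (hysi.const_mul α),
      intervalIntegral.integral_add hbi hci, intervalIntegral.integral_sub hψi hysi,
      intervalIntegral.integral_const_mul, intervalIntegral.integral_const_mul,
      intervalIntegral.integral_const, intervalIntegral.integral_const]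
    simp only [smul_eq_mul, sub_zero]
    ring
  · intro s hs
    have := hbc s hs
    show b s + c ≤ 0
    linarith

/-- **From a kernel floor to a dipole floor.** If `𝒥(r) ≥ (1 − e^{−2γr})/4` on `[0, t₀]` with `γ > 0`, `0 ≤ t₀`,
`2γ t₀ ≤ 1` and `𝒥` interval integrable on `[0, t₀]`, then `∫₀^{t₀} 𝒥 ≥ γ t₀² / 8`. -/
theorem sq_floor_of_kernel_floor {𝒥 : ℝ → ℝ} {γ t₀ : ℝ} (hγ : 0 < γ) (ht₀ : 0 ≤ t₀) (h2 : 2 * γ * t₀ ≤ 1)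
    (hint : IntervalIntegrable 𝒥 volume 0 t₀)
    (hfloor : ∀ r ∈ Icc 0 t₀, (1 - Real.exp (-(2 * γ * r))) / 4 ≤ 𝒥 r) :
    γ * t₀ ^ 2 / 8 ≤ ∫ s in (0:ℝ)..t₀, 𝒥 s := by
  have hlin : ∀ r ∈ Icc 0 t₀, γ * r / 4 ≤ 𝒥 r := by
    intro r hr
    have hx0 : 0 ≤ 2 * γ * r := by have := hr.1; positivity
    have hx1 : 2 * γ * r ≤ 1 := le_trans (by nlinarith [hr.2, hγ.le]) h2
    have h := Literature.NumberTheory.LFunctions.PrimeReciprocal.half_le_one_sub_exp_neg hx0 hx1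
    have h' := hfloor r hr
    linarith
  have hmono := intervalIntegral.integral_mono_on ht₀ ((by fun_prop : Continuous fun r => γ * r / 4).intervalIntegrable 0 t₀)
    hint hlin
  have hval : ∫ r in (0:ℝ)..t₀, γ * r / 4 = γ * t₀ ^ 2 / 8 := by
    have : (fun r => γ * r / 4) = fun r => (γ / 4) * r := by funext r; ring
    rw [this, intervalIntegral.integral_const_mul, integral_id]
    ring
  linarith

/-- **Registered helper `helper_kdDampedComparison` (stub S, line `kick-dipole-no-collapse`).**  Closed form of
`le_of_dampedIntegralEq_of_forcing_le`: a solution of the linearly damped integral equation `ψ(r) = ∫₀ʳ (b − αψ)` on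
`[0, t₁]` (`α > 0`; `ψ, b` integrable) whose forcing satisfies `b ≤ −c` stays below `−(c/α)(1 − e^{−αr})`.  On the line it
is applied with `ψ(r) = ∫ J·(κ_r g) dμ_T` (minus `T²` times the kick-response kernel), `α = 2γ`, `b = (γ/2)(Φ_0 − Φ_{N−1})`. -/
theorem helper_kdDampedComparison : ∀ (ψ b : ℝ → ℝ) (α c t₁ : ℝ), 0 < α → 0 ≤ t₁ → IntegrableOn ψ (Set.Icc 0 t₁) → IntegrableOn b (Set.Icc 0 t₁) → (∀ r ∈ Set.Icc 0 t₁, ψ r = ∫ s in (0:ℝ)..r, (b s - α * ψ s)) → (∀ s ∈ Set.Icc 0 t₁, b s ≤ -c) → ∀ r ∈ Set.Icc 0 t₁, ψ r ≤ -(c / α) * (1 - Real.exp (-(α * r))) := by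
  intro ψ b α c t₁ hα ht₁ hψ hb heq hbc
  exact le_of_dampedIntegralEq_of_forcing_le hα ht₁ hψ hb heq hbc

end Summit.AtomisticToContinuum.FouriersLaw.Cruxes.ConductanceLowerBound.KickDipoleNoCollapse

end
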